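import Literature.Analysis.FluidPDE.MikadoPrincipalParts
import Literature.Analysis.Calculus.HalfSpaceSmoothSeries
import HarnessLib

/-!
# Space–time regularity of the Coiculescu–Palasek principal parts: `v⁽ⁱ⁾ ∈ C^∞((0,∞) × 𝕋³)`,
# with the time derivative and the space derivatives computed term by term

Analysis/FluidPDE support file (definitions with proved API; no named facts) on the discharge path of
the principal-parts hypothesis `hA` of
`Literature.Barriers.NavierStokesRegularity.CriticalDataSmoothNonuniqueness_of_principalParts_of_perturbationLe`
(M. P. Coiculescu, S. Palasek, Invent. Math. 244 (2025), arXiv:2503.14699). §5: "`v⁽ⁱ⁾ ∈ C^∞((0,1] × 𝕋³)`";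
Prop. 3.13 / §4.1 use `∂ₜ v⁽ⁱ⁾`, `Δ v⁽ⁱ⁾` computed blockwise. For the scheduled sums
`CP25.IterData.vSched s t = ∑' i, block (s i) t` of `MikadoPrincipalParts` (`h : I.Admissible`,
`hs : StrictMono s`):

* `CP25.IterData.Wprev`, `stLift_block_eq` — each block is a finite sum of products
  `e^{-r t} • V(x)` (`V = V_{j,k}`, `W_{j,k-1}`; `r = rate_{k,j}`, `2 rate_{k,j}`), hence jointly smooth
  (`contDiff_stLift_block`), with the half-space bounds `norm_iteratedFDeriv_stLift_block_le`
  (`‖Dⁿ‖ ≤ 6(Cᵥ_n + C̄w_n) Λ_nⁿ N_k^{2n+1} e^{-4π²N_k²τ}` on `{t ≥ τ}`, `τ ≥ 0`);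
* `CP25.IterData.Admissible.isSmoothSpaceTimeOn_vSched` — **`v` is jointly `C^∞` on `(0,∞) × 𝕋³`**
  (`Torus.IsSmoothSpaceTimeOn (Ioi 0)`, hence on every `Ioc 0 T`: `isSmoothSpaceTimeOn_vSched_Ioc`), by
  the half-space smooth-series theorem `contDiffOn_tsum_of_halfspace_bounds`;
* `CP25.IterData.blockDt`, `hasDerivAt_block_apply`, `hasDerivAt_vSched_apply`, `timeDeriv_vSched`,
  `timeDerivWithin_vSched` — **the time derivative term by term** (`hasDerivAt_tsum_of_isPreconnected`
  on `(t/2, ∞)`);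
* `CP25.IterData.Admissible.iteratedFDeriv_lift_vSched_apply`, `fderiv_lift_vSched_apply` — **space
  derivatives of every order term by term** at each `t > 0` (Mathlib `iteratedFDeriv_tsum_apply` with the
  lacunary block bounds).

## Mathlib / tree search

Tree: `contDiffOn_tsum_of_halfspace_bounds`, `norm_iteratedFDeriv_exp_smul_le` (`HalfSpaceSmoothSeries`),
`Torus.IsSmoothSpaceTimeOn`, `Torus.stLift`, `Torus.timeDeriv(Within)` (`TorusCalculus`), the block API of
`MikadoPrincipalParts`. Mathlib: `hasDerivAt_tsum_of_isPreconnected`, `iteratedFDeriv_tsum_apply`.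

## On the hypothesis `h : I.Admissible`

`CP25.IterData.Admissible I` (a `structure … : Prop` of `MikadoDataIteration`) bundles the standing
HYPOTHESES on the abstract inputs `I` (profile bounds, unit phases, positive averages, scale relations,
cut-off bounds); the theorems below take `h : I.Admissible` as a section hypothesis (`variable … include h`).
It is not a named fact and nothing here assumes a conclusion: the predicate is PROVED for the paper's
concrete inputs in `CP25.admissible_mkIter` (`MikadoInputs`), which is how these theorems are used.

## References

* M. P. Coiculescu, S. Palasek, Invent. Math. 244 (2025) 165–219, doi:10.1007/s00222-025-01396-z,
  arXiv:2503.14699: Def. 3.10, Prop. 3.13, §4.1 (eq. (4.1)), §5. [CoiculescuPalasek2025]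
* L. C. Evans, *Partial Differential Equations*, 2nd ed., AMS 2010, §2.3.1 (series solutions smooth for
  `t > 0`). [Evans2010]
-/

noncomputable section

open MeasureTheory Set Filter Function
open _root_.Topology
open scoped BigOperators ContDiff ENNReal

namespace Literature.Analysis.FluidPDE

namespace CP25

open Literature.Analysis.FunctionSpaces Literature.Analysis.FunctionSpaces.Torus Literature.Analysis.Calculus

namespace IterData

variable (I : IterData)

/-- The cascade fields one level down: `Wprev (k+1) j = W_{j,k}`, `Wprev 0 j = 0`, so that
`v̄_{k-1}(t) = ∑_j e^{-2 rate_{k,j} t} Wprev k j`. [cite: CoiculescuPalasek2025, Def. 3.10] -/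
def Wprev : ℕ → Fin 6 → UnitAddTorus (Fin 3) → EuclideanSpace ℝ (Fin 3)
  | 0 => fun _ _ => 0
  | k + 1 => I.Wfield k

/-- **The time derivative of a block**: `∂ₜ(v_k + v̄_{k-1})(t) = -∑_j rate e^{-rate t} V - ∑_j 2rate e^{-2rate t} Wprev`.
[cite: CoiculescuPalasek2025, §4.1] -/
def blockDt (k : ℕ) (t : ℝ) (x : UnitAddTorus (Fin 3)) : EuclideanSpace ℝ (Fin 3) :=
  ∑ j, ((-(I.rate k j) * Real.exp (-(I.rate k j * t))) • I.Vfield k j x +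
    (-(2 * I.rate k j) * Real.exp (-(2 * I.rate k j * t))) • I.Wprev k j x)

/-- The frequency constant `Λ_n = 10·4π² + κ_{n+2} + 4c_{n+2}` of the space–time bounds. [folklore] -/
def stFreq (n : ℕ) : ℝ := 10 * (4 * Real.pi ^ 2) + I.cst.κ (n + 2) + 4 * (derivProfileMassSup (Fin 3) (n + 2) + I.cst.cχ (n + 2))

/-- `v̄_{k-1}(t, x) = ∑_j e^{-2 rate_{k,j} t} Wprev k j x`. [cite: CoiculescuPalasek2025, Def. 3.10] -/
theorem cascadePrev_eq (k : ℕ) (t : ℝ) (x : UnitAddTorus (Fin 3)) :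
    I.cascadePrev k t x = ∑ j, Real.exp (-(2 * I.rate k j * t)) • I.Wprev k j x := by
  cases k with
  | zero => simp [cascadePrev, Wprev]
  | succ k => rfl

/-- The block as a finite sum of `e^{-rt} • field` terms. [cite: CoiculescuPalasek2025, Def. 3.10] -/
theorem block_eq (k : ℕ) (t : ℝ) (x : UnitAddTorus (Fin 3)) :
    I.block k t x = ∑ j, (Real.exp (-(I.rate k j * t)) • I.Vfield k j x +
      Real.exp (-(2 * I.rate k j * t)) • I.Wprev k j x) := by
  rw [block, vHeat, cascadePrev_eq, ← Finset.sum_add_distrib]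

/-- The space–time lift of a block. [folklore] -/
theorem stLift_block_eq (k : ℕ) :
    Torus.stLift (I.block k) = fun p : ℝ × EuclideanSpace ℝ (Fin 3) =>
      ∑ j, ((fun q : ℝ × EuclideanSpace ℝ (Fin 3) => Real.exp (-(I.rate k j * q.1)) • Torus.lift (I.Vfield k j) q.2) p +
        (fun q : ℝ × EuclideanSpace ℝ (Fin 3) => Real.exp (-(2 * I.rate k j * q.1)) • Torus.lift (I.Wprev k j) q.2) p) := by
  funext p
  rw [Torus.stLift, block_eq]
  rfl

/-- `rate ≤ 5 · 4π² N_k²` (`|η_j|² ≤ 5`). [cite: CoiculescuPalasek2025, Def. 3.1] -/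
theorem rate_le (k : ℕ) (j : Fin 6) : I.rate k j ≤ 5 * (4 * Real.pi ^ 2 * (I.N k : ℝ) ^ 2) := by
  unfold rate
  have h5 := normSqInt_nashNormal_le j
  have : 0 ≤ 4 * Real.pi ^ 2 * (I.N k : ℝ) ^ 2 := by positivity
  nlinarith

/-- The space–time lift of the scheduled sum is the series of the lifts of the blocks. [folklore] -/
theorem stLift_vSched_eq (s : ℕ → ℕ) :
    Torus.stLift (I.vSched s) = fun p => ∑' i, Torus.stLift (I.block (s i)) p := rfl

/-- The time derivative of a block. [cite: CoiculescuPalasek2025, §4.1] -/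
theorem hasDerivAt_block_apply (k : ℕ) (t : ℝ) (x : UnitAddTorus (Fin 3)) :
    HasDerivAt (fun τ => I.block k τ x) (I.blockDt k t x) t := by
  have hfun : (fun τ => I.block k τ x) = fun τ => ∑ j, (Real.exp (-(I.rate k j * τ)) • I.Vfield k j x +
      Real.exp (-(2 * I.rate k j * τ)) • I.Wprev k j x) := by
    funext τ; exact I.block_eq k τ x
  rw [hfun, blockDt]
  refine HasDerivAt.fun_sum fun j _ => ?_
  have h1 : HasDerivAt (fun τ => Real.exp (-(I.rate k j * τ))) (-(I.rate k j) * Real.exp (-(I.rate k j * t))) t :=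
    (((hasDerivAt_id' t).const_mul (I.rate k j)).fun_neg.exp).congr_deriv (by ring)
  have h2 : HasDerivAt (fun τ => Real.exp (-(2 * I.rate k j * τ)))
      (-(2 * I.rate k j) * Real.exp (-(2 * I.rate k j * t))) t :=
    (((hasDerivAt_id' t).const_mul (2 * I.rate k j)).fun_neg.exp).congr_deriv (by ring)
  exact (h1.smul_const _).add (h2.smul_const _)

namespace Admissible

variable {I} (h : I.Admissible)
include h

/-! ### The fields one level down -/

/-- `Wprev k j` in the currency at scale `N_k`. [cite: CoiculescuPalasek2025, Prop. 3.13 (vkbarbounds)] -/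
theorem hasLiftDerivBounds_Wprev (n k : ℕ) (j : Fin 6) :
    HasLiftDerivBounds n (I.Wprev k j) (I.cst.Cw n * I.N k)
      (4 * (derivProfileMassSup (Fin 3) (n + 2) + I.cst.cχ (n + 2)) * I.N k) := by
  cases k with
  | zero =>
    have hL : 0 ≤ 4 * (derivProfileMassSup (Fin 3) (n + 2) + I.cst.cχ (n + 2)) * I.N 0 := by
      have := one_le_derivProfileMassSup (d := Fin 3) (n + 2); have := h.cχ_nonneg (n + 2)
      have := (h.N_pos' 0).le; positivity
    have hC : 0 ≤ I.cst.Cw n * I.N 0 := by have := h.Cw_nonneg n; have := (h.N_pos' 0).le; positivity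
    exact (hasLiftDerivBounds_zero (d := Fin 3) (F := EuclideanSpace ℝ (Fin 3)) n hL).mono hC hL le_rfl
  | succ k => exact h.hasLiftDerivBounds_Wfield n k j

/-- `Wprev k j` is smooth. [folklore] -/
theorem isSmooth_Wprev (k : ℕ) (j : Fin 6) : IsSmooth (I.Wprev k j) := (h.hasLiftDerivBounds_Wprev 0 k j).isSmooth

/-- `1 ≤ Λ_n` and the three frequency comparisons `5c, κ_{n+2}, 4c_{n+2} ≤ Λ_n`. [folklore] -/
theorem stFreq_ge (n : ℕ) : 10 * (4 * Real.pi ^ 2) ≤ I.stFreq n ∧ I.cst.κ (n + 2) ≤ I.stFreq n ∧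
    4 * (derivProfileMassSup (Fin 3) (n + 2) + I.cst.cχ (n + 2)) ≤ I.stFreq n := by
  have h1 := (h.κ_pos (n + 2)).le
  have h2 : 0 ≤ 4 * (derivProfileMassSup (Fin 3) (n + 2) + I.cst.cχ (n + 2)) := by
    have := one_le_derivProfileMassSup (d := Fin 3) (n + 2); have := h.cχ_nonneg (n + 2); positivity
  have h3 : (0 : ℝ) ≤ 10 * (4 * Real.pi ^ 2) := by positivity
  unfold stFreq
  exact ⟨by linarith, by linarith, by linarith⟩

/-- `0 ≤ Λ_n`. [folklore] -/
theorem stFreq_nonneg (n : ℕ) : 0 ≤ I.stFreq n :=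
  le_trans (by positivity) (h.stFreq_ge n).1

/-! ### Joint smoothness of the blocks and the half-space bounds -/

/-- Each block is jointly `C^∞` in `(t, y)`. [folklore] -/
theorem contDiff_stLift_block (k : ℕ) : ContDiff ℝ ∞ (Torus.stLift (I.block k)) := by
  rw [stLift_block_eq]
  refine ContDiff.sum fun j _ => ContDiff.add ?_ ?_
  · exact ((Real.contDiff_exp.comp (contDiff_const.mul contDiff_fst).neg).smul
      ((h.isSmooth_Vfield k j).comp contDiff_snd))
  · exact ((Real.contDiff_exp.comp (contDiff_const.mul contDiff_fst).neg).smul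
      ((h.isSmooth_Wprev k j).comp contDiff_snd))

/-- The generic term bound specialised: for `V ∈ HasLiftDerivBounds n V C L` with `L ≤ Λ N²`,
`cN² ≤ r ≤ 10cN²` (`c = 4π²`), and `τ ≤ p.1` with `τ ≥ 0`:
`‖Dⁿ(e^{-r p.1} • lift V p.2)‖ ≤ C (Λ_n N²)ⁿ e^{-cN²τ}`. [folklore] -/
theorem norm_iteratedFDeriv_term_le {n k : ℕ} {V : UnitAddTorus (Fin 3) → EuclideanSpace ℝ (Fin 3)} {C L r : ℝ}
    (hV : HasLiftDerivBounds n V C L) (hL0 : 0 ≤ L) (hL : L ≤ I.stFreq n * (I.N k : ℝ) ^ 2)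
    (hr1 : 4 * Real.pi ^ 2 * (I.N k : ℝ) ^ 2 ≤ r) (hr2 : r ≤ 10 * (4 * Real.pi ^ 2 * (I.N k : ℝ) ^ 2))
    {τ : ℝ} (hτ : 0 ≤ τ) (p : ℝ × EuclideanSpace ℝ (Fin 3)) (hp : τ ≤ p.1) :
    ‖iteratedFDeriv ℝ n (fun q : ℝ × EuclideanSpace ℝ (Fin 3) => Real.exp (-(r * q.1)) • Torus.lift V q.2) p‖ ≤
      C * (2 * I.stFreq n * (I.N k : ℝ) ^ 2) ^ n * Real.exp (-(4 * Real.pi ^ 2 * (I.N k : ℝ) ^ 2 * τ)) := by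
  have hr0 : 0 ≤ r := le_trans (by positivity) hr1
  have hC : 0 ≤ C := hV.nonneg
  have hmain := norm_iteratedFDeriv_exp_smul_le (E := EuclideanSpace ℝ (Fin 3)) hV.isSmooth
    (fun i hi y => hV.bound hi y) hr0 p
  refine hmain.trans ?_
  have hN2 : 0 ≤ (I.N k : ℝ) ^ 2 := by positivity
  have hΛ := (h.stFreq_ge n).1
  -- `r + L ≤ 2 Λ N²`
  have hrl : r + L ≤ 2 * I.stFreq n * (I.N k : ℝ) ^ 2 := by nlinarith
  have hrl0 : 0 ≤ r + L := by positivity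
  -- `e^{-r p.1} ≤ e^{-cN²τ}`
  have hexp : Real.exp (-(r * p.1)) ≤ Real.exp (-(4 * Real.pi ^ 2 * (I.N k : ℝ) ^ 2 * τ)) := by
    rw [Real.exp_le_exp, neg_le_neg_iff]
    have hp0 : 0 ≤ p.1 := hτ.trans hp
    calc 4 * Real.pi ^ 2 * (I.N k : ℝ) ^ 2 * τ ≤ r * τ := mul_le_mul_of_nonneg_right hr1 hτ
      _ ≤ r * p.1 := mul_le_mul_of_nonneg_left hp hr0
  have hΛ0 := h.stFreq_nonneg n
  exact mul_le_mul (mul_le_mul_of_nonneg_left (pow_le_pow_left₀ hrl0 hrl n) hC) hexp (Real.exp_pos _).le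
    (mul_nonneg hC (pow_nonneg (by positivity) n))

/-- **Half-space bounds for the blocks**: for `τ ≥ 0`, `τ ≤ p.1`,
`‖Dⁿ(stLift (v_k + v̄_{k-1})) p‖ ≤ 6 (Cᵥ_n + C̄w_n) N_k (2Λ_n N_k²)ⁿ e^{-4π²N_k²τ}`. [cite: CoiculescuPalasek2025, Prop. 3.13 and §5] -/
theorem norm_iteratedFDeriv_stLift_block_le (n k : ℕ) {τ : ℝ} (hτ : 0 ≤ τ) (p : ℝ × EuclideanSpace ℝ (Fin 3))
    (hp : τ ≤ p.1) :
    ‖iteratedFDeriv ℝ n (Torus.stLift (I.block k)) p‖ ≤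
      6 * ((I.cst.Cv n + I.cst.Cw n) * I.N k) * (2 * I.stFreq n * (I.N k : ℝ) ^ 2) ^ n *
        Real.exp (-(4 * Real.pi ^ 2 * (I.N k : ℝ) ^ 2 * τ)) := by
  have hN1 : (1 : ℝ) ≤ I.N k := by exact_mod_cast h.one_le_N k
  have hN0 : (0 : ℝ) ≤ I.N k := by positivity
  have hNsq : (I.N k : ℝ) ≤ (I.N k : ℝ) ^ 2 := by nlinarith
  obtain ⟨hΛ1, hΛ2, hΛ3⟩ := h.stFreq_ge n
  have hΛ0 := h.stFreq_nonneg n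
  have hc0 : (0 : ℝ) < 4 * Real.pi ^ 2 := four_pi_sq_pos
  -- the two kinds of terms
  set fV : Fin 6 → ℝ × EuclideanSpace ℝ (Fin 3) → EuclideanSpace ℝ (Fin 3) := fun j q =>
    Real.exp (-(I.rate k j * q.1)) • Torus.lift (I.Vfield k j) q.2 with hfV
  set fW : Fin 6 → ℝ × EuclideanSpace ℝ (Fin 3) → EuclideanSpace ℝ (Fin 3) := fun j q =>
    Real.exp (-(2 * I.rate k j * q.1)) • Torus.lift (I.Wprev k j) q.2 with hfW
  have hcV : ∀ j, ContDiff ℝ ∞ (fV j) := fun j =>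
    (Real.contDiff_exp.comp (contDiff_const.mul contDiff_fst).neg).smul ((h.isSmooth_Vfield k j).comp contDiff_snd)
  have hcW : ∀ j, ContDiff ℝ ∞ (fW j) := fun j =>
    (Real.contDiff_exp.comp (contDiff_const.mul contDiff_fst).neg).smul ((h.isSmooth_Wprev k j).comp contDiff_snd)
  have hbV : ∀ j, ‖iteratedFDeriv ℝ n (fV j) p‖ ≤ I.cst.Cv n * I.N k * (2 * I.stFreq n * (I.N k : ℝ) ^ 2) ^ n *
      Real.exp (-(4 * Real.pi ^ 2 * (I.N k : ℝ) ^ 2 * τ)) := by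
    intro j
    have hκ := (h.κ_pos (n + 2)).le
    refine h.norm_iteratedFDeriv_term_le (h.hasLiftDerivBounds_Vfield n k j) (by positivity) ?_
      (I.rate_ge k j) ((I.rate_le k j).trans (by nlinarith)) hτ p hp
    calc I.cst.κ (n + 2) * (I.N k : ℝ) ≤ I.stFreq n * I.N k := mul_le_mul_of_nonneg_right hΛ2 hN0
      _ ≤ I.stFreq n * (I.N k : ℝ) ^ 2 := mul_le_mul_of_nonneg_left hNsq hΛ0
  have hbW : ∀ j, ‖iteratedFDeriv ℝ n (fW j) p‖ ≤ I.cst.Cw n * I.N k * (2 * I.stFreq n * (I.N k : ℝ) ^ 2) ^ n *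
      Real.exp (-(4 * Real.pi ^ 2 * (I.N k : ℝ) ^ 2 * τ)) := by
    intro j
    have hc' : 0 ≤ 4 * (derivProfileMassSup (Fin 3) (n + 2) + I.cst.cχ (n + 2)) := by
      have := one_le_derivProfileMassSup (d := Fin 3) (n + 2); have := h.cχ_nonneg (n + 2); positivity
    have hrate := I.rate_ge k j
    have hrate' := I.rate_le k j
    refine h.norm_iteratedFDeriv_term_le (h.hasLiftDerivBounds_Wprev n k j) (by positivity) ?_
      (by nlinarith) (by nlinarith) hτ p hp
    calc 4 * (derivProfileMassSup (Fin 3) (n + 2) + I.cst.cχ (n + 2)) * (I.N k : ℝ) ≤ I.stFreq n * I.N k :=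
          mul_le_mul_of_nonneg_right hΛ3 hN0
      _ ≤ I.stFreq n * (I.N k : ℝ) ^ 2 := mul_le_mul_of_nonneg_left hNsq hΛ0
  -- sum over `j`
  have hfun : Torus.stLift (I.block k) = fun q => ∑ j, (fV j + fW j) q := I.stLift_block_eq k
  rw [hfun]
  simp only [Pi.add_apply]
  rw [iteratedFDeriv_fun_sum_apply (fun j _ =>
    (((hcV j).add (hcW j)).of_le (by exact_mod_cast le_top)).contDiffAt)]
  refine (norm_sum_le _ _).trans ?_
  have hterm : ∀ j ∈ (Finset.univ : Finset (Fin 6)), ‖iteratedFDeriv ℝ n (fun z => fV j z + fW j z) p‖ ≤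
      (I.cst.Cv n + I.cst.Cw n) * I.N k * (2 * I.stFreq n * (I.N k : ℝ) ^ 2) ^ n *
        Real.exp (-(4 * Real.pi ^ 2 * (I.N k : ℝ) ^ 2 * τ)) := by
    intro j _
    rw [fun_iteratedFDeriv_add_apply ((hcV j).of_le (by exact_mod_cast le_top)).contDiffAt
      ((hcW j).of_le (by exact_mod_cast le_top)).contDiffAt]
    refine (norm_add_le _ _).trans ?_
    have := add_le_add (hbV j) (hbW j)
    linarith
  refine (Finset.sum_le_sum hterm).trans (le_of_eq ?_)
  simp only [Finset.sum_const, Finset.card_univ, Fintype.card_fin, nsmul_eq_mul]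
  push_cast; ring

/-! ### Joint smoothness of the scheduled sums -/

section Sched

variable {s : ℕ → ℕ}

/-- **`v` is jointly `C^∞` on `(0, ∞) × 𝕋³`**, and its space–time iterated derivatives are the sums of
those of the blocks at every point with `t > 0`. [cite: CoiculescuPalasek2025, §5 ("`v⁽ⁱ⁾ ∈ C^∞((0,1]×𝕋³)`")] -/
theorem contDiffOn_stLift_vSched (hs : StrictMono s) :
    ContDiffOn ℝ ∞ (Torus.stLift (I.vSched s)) (Ioi (0 : ℝ) ×ˢ (univ : Set (EuclideanSpace ℝ (Fin 3)))) ∧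
      ∀ p₀ : ℝ × EuclideanSpace ℝ (Fin 3), 0 < p₀.1 →
        ContDiffAt ℝ ∞ (Torus.stLift (I.vSched s)) p₀ ∧
        ∀ n : ℕ, iteratedFDeriv ℝ n (Torus.stLift (I.vSched s)) p₀ =
          ∑' i, iteratedFDeriv ℝ n (Torus.stLift (I.block (s i))) p₀ := by
  rw [stLift_vSched_eq]
  refine contDiffOn_tsum_of_halfspace_bounds (fun i => h.contDiff_stLift_block (s i)) fun τ hτ n => ?_
  refine ⟨fun i => 6 * ((I.cst.Cv n + I.cst.Cw n) * I.N (s i)) * (2 * I.stFreq n * (I.N (s i) : ℝ) ^ 2) ^ n *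
      Real.exp (-(4 * Real.pi ^ 2 * (I.N (s i) : ℝ) ^ 2 * τ)), ?_,
    fun i p hp => h.norm_iteratedFDeriv_stLift_block_le n (s i) hτ.le p hp⟩
  -- summability: the majorant is `const · N^{2n+1} e^{-cN²τ}`
  have hsum := (h.summable_schedN_rpow hs (a := ((2 * n + 1 : ℕ) : ℝ)) (by positivity) hτ).mul_left
    (6 * (I.cst.Cv n + I.cst.Cw n) * (2 * I.stFreq n) ^ n)
  refine hsum.congr fun i => ?_
  rw [Real.rpow_natCast]
  ring

/-- **`Torus.IsSmoothSpaceTimeOn (Ioi 0) v`.** [cite: CoiculescuPalasek2025, §5] -/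
theorem isSmoothSpaceTimeOn_vSched (hs : StrictMono s) : Torus.IsSmoothSpaceTimeOn (Ioi 0) (I.vSched s) :=
  (h.contDiffOn_stLift_vSched hs).1

/-- `Torus.IsSmoothSpaceTimeOn (Ioc 0 T) v` — literally `IsClassicalNSSolutionOn.smooth_velocity`.
[cite: CoiculescuPalasek2025, §5] -/
theorem isSmoothSpaceTimeOn_vSched_Ioc (hs : StrictMono s) (T : ℝ) :
    Torus.IsSmoothSpaceTimeOn (Ioc 0 T) (I.vSched s) :=
  (h.isSmoothSpaceTimeOn_vSched hs).mono Ioc_subset_Ioi_self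

/-! ### The time derivative term by term -/

/-- The bound `‖∂ₜ block_k(t, x)‖ ≤ 60π² (Cᵥ₀ + C̄w₀) N_k³ e^{-4π²N_k²t}` for `t ≥ 0`. [cite: CoiculescuPalasek2025, §4.1] -/
theorem norm_blockDt_le (k : ℕ) {t : ℝ} (ht : 0 ≤ t) (x : UnitAddTorus (Fin 3)) :
    ‖I.blockDt k t x‖ ≤ 6 * (10 * (4 * Real.pi ^ 2)) * (I.cst.Cv 0 + I.cst.Cw 0) *
      ((I.N k : ℝ) ^ 3 * Real.exp (-(4 * Real.pi ^ 2 * (I.N k : ℝ) ^ 2 * t))) := by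
  have hN0 : (0 : ℝ) ≤ I.N k := (h.N_pos' k).le
  have hc0 : (0 : ℝ) < 4 * Real.pi ^ 2 := four_pi_sq_pos
  set e := Real.exp (-(4 * Real.pi ^ 2 * (I.N k : ℝ) ^ 2 * t)) with he
  have hterm : ∀ j ∈ (Finset.univ : Finset (Fin 6)),
      ‖(-(I.rate k j) * Real.exp (-(I.rate k j * t))) • I.Vfield k j x +
        (-(2 * I.rate k j) * Real.exp (-(2 * I.rate k j * t))) • I.Wprev k j x‖ ≤
      (10 * (4 * Real.pi ^ 2)) * (I.cst.Cv 0 + I.cst.Cw 0) * ((I.N k : ℝ) ^ 3 * e) := by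
    intro j _
    have hr0 := I.rate_nonneg k j
    have hr := I.rate_le k j
    have hV := (h.hasLiftDerivBounds_Vfield 0 k j).norm_le x
    have hW := (h.hasLiftDerivBounds_Wprev 0 k j).norm_le x
    have he1 : Real.exp (-(I.rate k j * t)) ≤ e := I.exp_neg_rate_le k j ht
    have he2 : Real.exp (-(2 * I.rate k j * t)) ≤ e := by
      refine le_trans ?_ he1
      rw [Real.exp_le_exp, neg_le_neg_iff]; nlinarith
    have hCv : 0 ≤ I.cst.Cv 0 * I.N k := by have := h.Cv_nonneg 0; positivity
    have hCw : 0 ≤ I.cst.Cw 0 * I.N k := by have := h.Cw_nonneg 0; positivity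
    refine (norm_add_le _ _).trans ?_
    rw [norm_smul, norm_smul, Real.norm_eq_abs, Real.norm_eq_abs, abs_mul, abs_mul, abs_neg, abs_neg,
      abs_of_nonneg hr0, abs_of_nonneg (by positivity : (0:ℝ) ≤ 2 * I.rate k j),
      abs_of_nonneg (Real.exp_pos _).le, abs_of_nonneg (Real.exp_pos _).le]
    have h1 : I.rate k j * Real.exp (-(I.rate k j * t)) * ‖I.Vfield k j x‖ ≤
        5 * (4 * Real.pi ^ 2 * (I.N k : ℝ) ^ 2) * e * (I.cst.Cv 0 * I.N k) :=
      mul_le_mul (mul_le_mul hr he1 (Real.exp_pos _).le (by positivity)) hV (norm_nonneg _) (by positivity)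
    have h2 : 2 * I.rate k j * Real.exp (-(2 * I.rate k j * t)) * ‖I.Wprev k j x‖ ≤
        2 * (5 * (4 * Real.pi ^ 2 * (I.N k : ℝ) ^ 2)) * e * (I.cst.Cw 0 * I.N k) :=
      mul_le_mul (mul_le_mul (by nlinarith) he2 (Real.exp_pos _).le (by positivity)) hW (norm_nonneg _)
        (by positivity)
    have he0 : 0 ≤ e := (Real.exp_pos _).le
    nlinarith [mul_nonneg (mul_nonneg he0 hCv) (sq_nonneg (I.N k : ℝ)),
      mul_nonneg (mul_nonneg he0 hCw) (sq_nonneg (I.N k : ℝ))]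
  unfold blockDt
  refine (norm_sum_le _ _).trans ((Finset.sum_le_sum hterm).trans (le_of_eq ?_))
  simp only [Finset.sum_const, Finset.card_univ, Fintype.card_fin, nsmul_eq_mul]
  push_cast; ring

/-- **The time derivative of the scheduled sum, term by term**: for `t > 0`,
`HasDerivAt (τ ↦ v(τ, x)) (∑' i, ∂ₜ block_{s i}(t, x)) t`. [cite: CoiculescuPalasek2025, §4.1] -/
theorem hasDerivAt_vSched_apply (hs : StrictMono s) {t : ℝ} (ht : 0 < t) (x : UnitAddTorus (Fin 3)) :
    HasDerivAt (fun τ => I.vSched s τ x) (∑' i, I.blockDt (s i) t x) t := by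
  have hτ : 0 < t / 2 := half_pos ht
  set u : ℕ → ℝ := fun i => 6 * (10 * (4 * Real.pi ^ 2)) * (I.cst.Cv 0 + I.cst.Cw 0) *
    ((I.N (s i) : ℝ) ^ 3 * Real.exp (-(4 * Real.pi ^ 2 * (I.N (s i) : ℝ) ^ 2 * (t / 2)))) with hu
  have hu_sum : Summable u := by
    have hsum := (h.summable_schedN_rpow hs (a := ((3 : ℕ) : ℝ)) (by positivity) hτ).mul_left
      (6 * (10 * (4 * Real.pi ^ 2)) * (I.cst.Cv 0 + I.cst.Cw 0))
    refine hsum.congr fun i => ?_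
    rw [Real.rpow_natCast]
  have hderiv : ∀ (i : ℕ) (τ : ℝ), τ ∈ Ioi (t / 2) →
      HasDerivAt (fun τ => I.block (s i) τ x) (I.blockDt (s i) τ x) τ :=
    fun i τ _ => I.hasDerivAt_block_apply (s i) τ x
  have hbound : ∀ (i : ℕ) (τ : ℝ), τ ∈ Ioi (t / 2) → ‖I.blockDt (s i) τ x‖ ≤ u i := by
    intro i τ hτ'
    have hτ0 : 0 ≤ τ := hτ.le.trans (le_of_lt hτ')
    refine (h.norm_blockDt_le (s i) hτ0 x).trans ?_
    have hc : 0 ≤ 6 * (10 * (4 * Real.pi ^ 2)) * (I.cst.Cv 0 + I.cst.Cw 0) := by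
      have := h.Cv_nonneg 0; have := h.Cw_nonneg 0; positivity
    refine mul_le_mul_of_nonneg_left (mul_le_mul_of_nonneg_left ?_ (by positivity)) hc
    rw [Real.exp_le_exp, neg_le_neg_iff]
    exact mul_le_mul_of_nonneg_left (le_of_lt hτ') (by positivity)
  have h0 : Summable fun i => I.block (s i) t x := h.summable_block_apply hs ht x
  exact hasDerivAt_tsum_of_isPreconnected hu_sum isOpen_Ioi isPreconnected_Ioi hderiv hbound
    (by simp [ht] : t ∈ Ioi (t / 2)) h0 (by simp [ht] : t ∈ Ioi (t / 2))

/-- `Torus.timeDeriv v t x = ∑' i, ∂ₜ block_{s i}(t, x)` for `t > 0`. [cite: CoiculescuPalasek2025, §4.1] -/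
theorem timeDeriv_vSched (hs : StrictMono s) {t : ℝ} (ht : 0 < t) (x : UnitAddTorus (Fin 3)) :
    Torus.timeDeriv (I.vSched s) t x = ∑' i, I.blockDt (s i) t x :=
  (h.hasDerivAt_vSched_apply hs ht x).deriv

/-- The one-sided time derivative within any time set with unique tangents (e.g. `Ioc 0 T` at its points)
agrees: `Torus.timeDerivWithin S v t x = ∑' i, ∂ₜ block_{s i}(t, x)`. [cite: CoiculescuPalasek2025, §4.1] -/
theorem timeDerivWithin_vSched (hs : StrictMono s) {S : Set ℝ} {t : ℝ} (hS : UniqueDiffWithinAt ℝ S t)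
    (ht : 0 < t) (x : UnitAddTorus (Fin 3)) :
    Torus.timeDerivWithin S (I.vSched s) t x = ∑' i, I.blockDt (s i) t x :=
  ((h.hasDerivAt_vSched_apply hs ht x).hasDerivWithinAt).derivWithin hS

/-! ### Space derivatives term by term at a fixed time -/

/-- **Space derivatives of every order term by term**: for `t > 0` and every `n`, `y`,
`iteratedFDeriv ℝ n (lift v(t)) y = ∑' i, iteratedFDeriv ℝ n (lift block_{s i}(t)) y`.
[cite: CoiculescuPalasek2025, Prop. 3.13 (proof)] -/
theorem iteratedFDeriv_lift_vSched_apply (hs : StrictMono s) {t : ℝ} (ht : 0 < t) (n : ℕ)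
    (y : EuclideanSpace ℝ (Fin 3)) :
    iteratedFDeriv ℝ n (Torus.lift (I.vSched s t)) y =
      ∑' i, iteratedFDeriv ℝ n (Torus.lift (I.block (s i) t)) y := by
  have hlift : Torus.lift (I.vSched s t) = fun y => ∑' i, Torus.lift (I.block (s i) t) y := rfl
  rw [hlift]
  refine iteratedFDeriv_tsum_apply (N := (⊤ : ℕ∞))
    (v := fun m i => I.cst.Bblk m * ((I.N (s i) : ℝ) ^ ((m : ℝ) + 1) *
      Real.exp (-(4 * Real.pi ^ 2 * (I.N (s i) : ℝ) ^ 2 * t))))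
    (fun i => h.isSmooth_block (s i) t) (fun m _ => ?_) (fun m i y _ => h.norm_iteratedFDeriv_lift_block_le m (s i) ht.le y)
    (by exact_mod_cast le_top) y
  exact (h.summable_schedN_rpow hs (by positivity : (0:ℝ) < (m : ℝ) + 1) ht).mul_left _

/-- **The Fréchet derivative of the lift term by term** (`n = 1`). [cite: CoiculescuPalasek2025, Prop. 3.13 (proof)] -/
theorem fderiv_lift_vSched_apply (hs : StrictMono s) {t : ℝ} (ht : 0 < t) (y : EuclideanSpace ℝ (Fin 3)) :
    fderiv ℝ (Torus.lift (I.vSched s t)) y = ∑' i, fderiv ℝ (Torus.lift (I.block (s i) t)) y := by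
  have hlift : Torus.lift (I.vSched s t) = fun y => ∑' i, Torus.lift (I.block (s i) t) y := rfl
  rw [hlift]
  refine fderiv_tsum_apply (f := fun i => Torus.lift (I.block (s i) t))
    (u := fun i => I.cst.Bblk 1 * ((I.N (s i) : ℝ) ^ (((1 : ℕ) : ℝ) + 1) *
      Real.exp (-(4 * Real.pi ^ 2 * (I.N (s i) : ℝ) ^ 2 * t)))) ?_ ?_ ?_
    (show Summable (fun i => Torus.lift (I.block (s i) t) y) from h.summable_block_apply hs ht (Torus.proj y)) y
  · exact (h.summable_schedN_rpow hs (by positivity : (0:ℝ) < ((1 : ℕ) : ℝ) + 1) ht).mul_left _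
  · exact fun i => ((h.isSmooth_block (s i) t).isContDiff (n := 1) (by simp)).differentiable (by simp)
  · intro i y
    rw [← norm_iteratedFDeriv_zero (𝕜 := ℝ) (f := fderiv ℝ (Torus.lift (I.block (s i) t))) (x := y),
      norm_iteratedFDeriv_fderiv]
    exact h.norm_iteratedFDeriv_lift_block_le 1 (s i) ht.le y

end Sched

end Admissible

end IterData

end CP25

end Literature.Analysis.FluidPDE
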